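import Summits.CriticalPhenomena.Ising3DConformalLimit.Theorems.EnergyNotSigmaSquaredMoebiusLimitExistsDefs
import Literature.Probability.LatticeModels.CriticalWickDichotomy
import Literature.Probability.LatticeModels.HighDimPointwiseTriviality
import HarnessLib

/-!
# Only interaction can break Wick: `U₄`-free cluster points of the pinned zoom are the Wick family
(line `only-interaction-breaks-moebius` of the crux `MoebiusLimitExists`, item stmt-CriticalPhenomena-1344;
stub `stub_freeClusterPointWick`)

A cluster point `S` of the pinned zoom of the critical `ℤ³` spin correlators (`IsClusterPoint S`:
locally uniform limits off the diagonals of `ρ_pin(u_k)ⁿ ⟨σ_{[x₁/u_k]} ⋯ σ_{[xₙ/u_k]}⟩_{β_c}` along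
ONE mesh sequence `u_k`, for every `n`) whose connected four-point function
`U₄^S = limitConnectedFour S` vanishes at non-coincident quadruples and whose two-point function is
the pure power `‖x₀ − x₁‖^{-2Δ}` coincides, on every `NonCoincident 3 n`, with the Wick family
`wickPower Δ` (the Gaussian pairing functional `𝒢_m[‖·−·‖^{-2Δ}]` at even order `2m`, `0` at odd
order). In `MoebiusLimitExists_of` this identifies every free cluster point with `W_Δ`.

Engine: the SEQUENTIAL form (filter `atTop` along the mesh sequence in place of `𝓝[>] 0`) of the
tree theorem `HasPointwiseScalingLimit.eq_pairingSum_of_limitConnectedFour_eq_zero`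
(`CriticalWickDichotomy`): Aizenman's Proposition 12.1 for the critical state,
`|⟨∏σ_{yᵢ}⟩_{β_c} − 𝒢_m[⟨σσ⟩_{β_c}](y)| ≤ (3/2) Σ_{4-subsets} |U₄| 𝒢_{m-2}`
(`abs_criticalCorr_sub_pairingSum_le`), is rescaled by `ρ(u_k)^{2m}` at the lattice points
`[xᵢ/u_k]`, rewritten at the level of INDICES (`PairIsing.pairingSum_eq_pow_mul`,
`wickRemainder_eq_pow_mul_of_ne`: pairings and `4`-subsets only read distinct indices) and passed to
the limit `k → ∞` (`tendsto_pairingSum`, `tendsto_wickRemainder`) using the convergence of the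
rescaled two- and four-point data at non-coincident configurations only; this gives
`S (2m) x = 𝒢_m[S₂](x)` for `m ≥ 2`. Order `2` is the hypothesis, order `0` is `⟨1⟩_{β_c} = 1`,
odd orders vanish for every cluster point (`criticalCorr_eq_zero_of_odd`, `m*(β_c) = 0`); finally
`S₂ = ‖·−·‖^{-2Δ}` at DISTINCT indices turns `𝒢_m[S₂](x)` into `𝒢_m[powerKernel Δ](x) =
wickPower Δ (2m) x`. The mesh sequence need not even tend to `0`: only the convergence clauses of
`IsClusterPoint` are used.

References: M. Aizenman, Comm. Math. Phys. 86 (1982) 1–48, Prop. 12.1, eq. (12.3)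
[AizenmanCMP1982]; M. Aizenman, *A geometric perspective on the scaling limits of critical Ising and
`φ⁴_d` models*, CDM 2020 (arXiv:2112.04248), Prop. 7.2 and the remark following it (p. 23)
[AizenmanCDM2020]; C. M. Newman, Comm. Math. Phys. 41 (1975) 1–9 [Newman1975];
M. Aizenman, H. Duminil-Copin, V. Sidoravicius, Comm. Math. Phys. 334 (2015), Thm. 1.2
[AizenmanDuminilCopinSidoraviciusCMP2015].
-/

noncomputable section

open Filter Topology Set Function
open Literature.Probability.LatticeModels

namespace Summit.CriticalPhenomena.Ising3DConformalLimit.MoebiusLimitExistsOnlyInteraction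

/-! ### Lattice dictionary at order `0` -/

/-- `⟨1⟩⁺_{β_c} = 1` on `ℤ³`: the empty spin monomial is the constant observable `1`, every box
expectation of which is `1`, so the `limUnder` along boxes is a genuine limit. [folklore] -/
private theorem criticalCorr_fin_zero (y : Fin 0 → Site 3) : criticalCorr 3 0 y = 1 := by
  have hy : spinMonomial y = fun _ => (1 : ℝ) := by
    funext s; simp [spinMonomial]
  show plusExpect 3 (criticalBeta 3) 0 (spinMonomial y) = 1
  rw [hy]
  show limUnder atTop
      (fun L : ℕ => isingExpect (zdGraph 3) (box 3 L) (criticalBeta 3) 0 .plus (fun _ => (1 : ℝ))) = 1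
  simp_rw [isingExpect_const]
  exact tendsto_const_nhds.limUnder_eq

/-- The rescaled `0`-point critical correlator is the constant `1` (any renormalisation, any mesh).
[folklore] -/
private theorem rescaledCorrelator_criticalCorr_zero (ρ : ℝ → ℝ) (δ : ℝ)
    (y : Fin 0 → EuclideanSpace ℝ (Fin 3)) : rescaledCorrelator (criticalCorr 3) ρ 0 δ y = 1 := by
  rw [rescaledCorrelator_apply, pow_zero, one_mul, criticalCorr_fin_zero]

/-! ### Sequential limits of the rescaled lattice data -/

/-- Along a mesh sequence `u_k`, the rescaled lattice Ursell function `ρ(u_k)⁴ U₄([x/u_k])` converges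
to `U₄^S(x) = limitConnectedFour S x` as soon as the rescaled `2`- and `4`-point critical correlators
converge to `S` at non-coincident configurations (sequential form of
`tendsto_rescaled_criticalUrsellFour`). [cite: AizenmanCDM2020, §10.1 eqs. (10.1)–(10.2)] -/
private theorem tendsto_rescaled_criticalUrsellFour_seq {u : ℕ → ℝ} {ρ : ℝ → ℝ} {S : CorrFamily 3}
    (hconv : ∀ n, TendstoLocallyUniformlyOn
      (fun k => rescaledCorrelator (criticalCorr 3) ρ n (u k)) (S n) atTop (NonCoincident 3 n))
    {x : Fin 4 → EuclideanSpace ℝ (Fin 3)} (hx : x ∈ NonCoincident 3 4) :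
    Tendsto (fun k => ρ (u k) ^ 4 * (criticalCorr 3 4 (fun i => latticeApprox (u k) (x i)) -
      (criticalCorr 3 2 ![latticeApprox (u k) (x 0), latticeApprox (u k) (x 1)] *
          criticalCorr 3 2 ![latticeApprox (u k) (x 2), latticeApprox (u k) (x 3)]
        + criticalCorr 3 2 ![latticeApprox (u k) (x 0), latticeApprox (u k) (x 2)] *
          criticalCorr 3 2 ![latticeApprox (u k) (x 1), latticeApprox (u k) (x 3)]
        + criticalCorr 3 2 ![latticeApprox (u k) (x 0), latticeApprox (u k) (x 3)] *
          criticalCorr 3 2 ![latticeApprox (u k) (x 1), latticeApprox (u k) (x 2)]))) atTop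
      (𝓝 (limitConnectedFour S x)) := by
  have hinj : Function.Injective x := hx
  have hpair : ∀ i j, i ≠ j → Tendsto
      (fun k => ρ (u k) ^ 2 *
        criticalCorr 3 2 ![latticeApprox (u k) (x i), latticeApprox (u k) (x j)])
      atTop (𝓝 (S 2 ![x i, x j])) := by
    intro i j hij
    have hmem : (![x i, x j] : Fin 2 → EuclideanSpace ℝ (Fin 3)) ∈ NonCoincident 3 2 :=
      pair_mem_nonCoincident fun h => hij (hinj h)
    refine Tendsto.congr (fun k => ?_) ((hconv 2).tendsto_at hmem)
    show rescaledCorrelator (criticalCorr 3) ρ 2 (u k) ![x i, x j] = _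
    rw [rescaledCorrelator_apply, latticeApprox_comp_two]
    rfl
  have h4 : Tendsto (fun k => ρ (u k) ^ 4 * criticalCorr 3 4 (fun i => latticeApprox (u k) (x i)))
      atTop (𝓝 (S 4 x)) := (hconv 4).tendsto_at hx
  have h := h4.sub ((((hpair 0 1 (by decide)).mul (hpair 2 3 (by decide))).add
    ((hpair 0 2 (by decide)).mul (hpair 1 3 (by decide)))).add
    ((hpair 0 3 (by decide)).mul (hpair 1 2 (by decide))))
  have hlim_eq : limitConnectedFour S x = S 4 x - (S 2 ![x 0, x 1] * S 2 ![x 2, x 3]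
      + S 2 ![x 0, x 2] * S 2 ![x 1, x 3] + S 2 ![x 0, x 3] * S 2 ![x 1, x 2]) := rfl
  rw [hlim_eq]
  refine Tendsto.congr (fun k => ?_) h
  ring

/-- **Sequential Gaussian dichotomy, Wick side** (Aizenman 1982 Prop. 12.1 ⇒ Wick, along a mesh
SEQUENCE): if the rescaled critical `ℤ³` correlators converge to `S` at non-coincident
configurations along `u_k` for every order, and `U₄^S` vanishes at all non-coincident quadruples,
then `S_{2n}(x) = 𝒢_n[S₂](x)` for `n ≥ 2` and `x` non-coincident, `S₂(p,q) = S 2 ![p,q]`.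
Transcription of `HasPointwiseScalingLimit.eq_pairingSum_of_limitConnectedFour_eq_zero` with the
filter `𝓝[>] 0` replaced by `atTop` along the sequence. [cite: AizenmanCMP1982, Prop. 12.1, eq. (12.3)] [cite: AizenmanCDM2020, §7, Prop. 7.2 and the remark following it (p. 23)] -/
private theorem eq_pairingSum_of_seq_of_limitConnectedFour_eq_zero {u : ℕ → ℝ} {ρ : ℝ → ℝ}
    {S : CorrFamily 3}
    (hconv : ∀ n, TendstoLocallyUniformlyOn
      (fun k => rescaledCorrelator (criticalCorr 3) ρ n (u k)) (S n) atTop (NonCoincident 3 n))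
    (hU : ∀ z ∈ NonCoincident 3 4, limitConnectedFour S z = 0) {n : ℕ} (hn : 2 ≤ n)
    {x : Fin (2 * n) → EuclideanSpace ℝ (Fin 3)} (hx : x ∈ NonCoincident 3 (2 * n)) :
    S (2 * n) x = pairingSum (fun p q => S 2 ![p, q]) n x := by
  classical
  have hd : 3 ≤ 3 := le_rfl
  have hinj : Function.Injective x := hx
  -- lattice data at mesh `u k`, read at the level of INDICES (diagonal / non-injective entries zeroed)
  set C2 : Site 3 → Site 3 → ℝ := fun a b => criticalCorr 3 2 ![a, b]
  set U4c : (Fin 4 → Site 3) → ℝ := fun w => criticalCorr 3 4 w - (C2 (w 0) (w 1) * C2 (w 2) (w 3)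
      + C2 (w 0) (w 2) * C2 (w 1) (w 3) + C2 (w 0) (w 3) * C2 (w 1) (w 2))
  set z : ℕ → Fin (2 * n) → Site 3 := fun k i => latticeApprox (u k) (x i)
  set T : ℕ → Fin (2 * n) → Fin (2 * n) → ℝ := fun k i j =>
      if i = j then 0 else ρ (u k) ^ 2 * C2 (z k i) (z k j) with hT
  set T₀ : Fin (2 * n) → Fin (2 * n) → ℝ := fun i j => if i = j then 0 else S 2 ![x i, x j] with hT₀
  set V : ℕ → (Fin 4 → Fin (2 * n)) → ℝ := fun k e =>
      if Function.Injective e then ρ (u k) ^ 4 * U4c (z k ∘ e) else 0 with hV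
  -- (1) index-level rescaling identities
  have hP : ∀ k, pairingSum (T k) n id = (ρ (u k) ^ 2) ^ n * pairingSum C2 n (z k) := fun k =>
    PairIsing.pairingSum_eq_pow_mul C2 (T k) (ρ (u k) ^ 2) n (z k) id fun i j hij => by
      simp only [hT, id, if_neg hij]
  have hR : ∀ k, wickRemainder (T k) (V k) n id =
      (ρ (u k) ^ 2) ^ n * wickRemainder C2 U4c n (z k) :=
    fun k => wickRemainder_eq_pow_mul_of_ne C2 (T k) U4c (V k) (ρ (u k) ^ 2) hn (z k) id
      (fun i j hij => by simp only [hT, id, if_neg hij])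
      (fun e he => by
        simp only [hV, Function.id_comp, if_pos he]
        ring)
  -- (2) the rescaled lattice inequality at mesh `u k`
  have hineq : ∀ k, |ρ (u k) ^ (2 * n) * criticalCorr 3 (2 * n) (z k) - pairingSum (T k) n id| ≤
      3 / 2 * wickRemainder (T k) (V k) n id := by
    intro k
    have h : |criticalCorr 3 (2 * n) (z k) - pairingSum C2 n (z k)| ≤
        3 / 2 * wickRemainder C2 U4c n (z k) := abs_criticalCorr_sub_pairingSum_le hd hn (z k)
    have hc : 0 ≤ (ρ (u k) ^ 2) ^ n := by positivity
    rw [hP, hR, pow_mul, ← mul_sub, abs_mul, abs_of_nonneg hc]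
    calc (ρ (u k) ^ 2) ^ n * |criticalCorr 3 (2 * n) (z k) - pairingSum C2 n (z k)|
        ≤ (ρ (u k) ^ 2) ^ n * (3 / 2 * wickRemainder C2 U4c n (z k)) :=
          mul_le_mul_of_nonneg_left h hc
      _ = 3 / 2 * ((ρ (u k) ^ 2) ^ n * wickRemainder C2 U4c n (z k)) := by ring
  -- (3) limits along `k → ∞`
  have hpair : ∀ i j, i ≠ j → Tendsto (fun k => ρ (u k) ^ 2 * C2 (z k i) (z k j)) atTop
      (𝓝 (S 2 ![x i, x j])) := by
    intro i j hij
    have hmem : (![x i, x j] : Fin 2 → EuclideanSpace ℝ (Fin 3)) ∈ NonCoincident 3 2 :=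
      pair_mem_nonCoincident fun h => hij (hinj h)
    refine Tendsto.congr (fun k => ?_) ((hconv 2).tendsto_at hmem)
    show rescaledCorrelator (criticalCorr 3) ρ 2 (u k) ![x i, x j] = _
    rw [rescaledCorrelator_apply, latticeApprox_comp_two]
    rfl
  have hTlim : ∀ i j, Tendsto (fun k => T k i j) atTop (𝓝 (T₀ i j)) := by
    intro i j
    by_cases hij : i = j
    · simp only [hT, hT₀, if_pos hij]
      exact tendsto_const_nhds
    · simp only [hT, hT₀, if_neg hij]
      exact hpair i j hij
  have hVlim : ∀ e : Fin 4 → Fin (2 * n), Tendsto (fun k => V k e) atTop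
      (𝓝 ((fun _ : Fin 4 → Fin (2 * n) => (0 : ℝ)) e)) := by
    intro e
    by_cases he : Function.Injective e
    · simp only [hV, if_pos he]
      have hxe : (x ∘ e) ∈ NonCoincident 3 4 := hinj.comp he
      have h1 : Tendsto (fun k => ρ (u k) ^ 4 * U4c (z k ∘ e)) atTop
          (𝓝 (limitConnectedFour S (x ∘ e))) := tendsto_rescaled_criticalUrsellFour_seq hconv hxe
      rwa [hU _ hxe] at h1
    · simp only [hV, if_neg he]
      exact tendsto_const_nhds
  have hL : Tendsto
      (fun k => ρ (u k) ^ (2 * n) * criticalCorr 3 (2 * n) (z k) - pairingSum (T k) n id)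
      atTop (𝓝 (S (2 * n) x - pairingSum T₀ n id)) :=
    ((hconv (2 * n)).tendsto_at hx).sub (tendsto_pairingSum hTlim n id)
  have hRlim : Tendsto (fun k => 3 / 2 * wickRemainder (T k) (V k) n id) atTop
      (𝓝 (3 / 2 * wickRemainder T₀ (fun _ => (0 : ℝ)) n id)) :=
    Tendsto.const_mul _ (tendsto_wickRemainder hTlim hVlim n id)
  have hR0 : wickRemainder T₀ (fun _ : Fin 4 → Fin (2 * n) => (0 : ℝ)) n id = 0 := by
    simp [wickRemainder]
  have hle : |S (2 * n) x - pairingSum T₀ n id| ≤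
      3 / 2 * wickRemainder T₀ (fun _ => (0 : ℝ)) n id :=
    le_of_tendsto_of_tendsto hL.abs hRlim (Filter.Eventually.of_forall hineq)
  rw [hR0, mul_zero, abs_nonpos_iff, sub_eq_zero] at hle
  -- (4) back to the point-level pairing functional
  rw [hle, PairIsing.pairingSum_eq_pow_mul (fun p q => S 2 ![p, q]) T₀ 1 n x id fun i j hij => by
    simp only [hT₀, id, if_neg hij, one_mul], one_pow, one_mul]

/-! ### The stub -/

/-- **STUB 3 of the line `only-interaction-breaks-moebius` — ONLY INTERACTION CAN BREAK WICK: a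
`U₄`-free cluster point with the pure-power two-point function IS the Wick family `W_Δ` off the
diagonals.** For a cluster point `S` of the pinned zoom with `S 2 (x₀,x₁) = ‖x₀ − x₁‖^{-2Δ}` on
non-coincident pairs and `U₄^S = 0` on non-coincident quadruples, `S n x = wickPower Δ n x` for every
`n` and every non-coincident `x`: at even order `2m ≥ 4` by the sequential Gaussian dichotomy
`S (2m) x = 𝒢_m[S₂](x)` (Aizenman 1982 Prop. 12.1 rescaled along the mesh sequence) and the
two-point law at distinct indices (`𝒢_m` only reads `S₂(xᵢ,xⱼ)`, `i ≠ j`); order `2` is the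
two-point law (`wickPower_two`); order `0` is `⟨1⟩_{β_c} = 1 = wickPower Δ 0`; odd orders vanish
for every cluster point (`m*(β_c) = 0`) as does `wickPower Δ`. [cite: AizenmanCMP1982, Prop. 12.1, eq. (12.3)] [cite: AizenmanCDM2020, Prop. 7.2 and remark p. 23] [cite: Newman1975, Thm. 4 eq. (2.5)] -/
theorem stub_freeClusterPointWick :
    ∀ (Δ : ℝ) (S : CorrFamily 3), IsClusterPoint S →
      (∀ x ∈ NonCoincident 3 2, S 2 x = ‖x 0 - x 1‖ ^ (-(2 * Δ))) →
      (∀ z ∈ NonCoincident 3 4, limitConnectedFour S z = 0) →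
      ∀ n, ∀ x ∈ NonCoincident 3 n, S n x = wickPower Δ n x := by
  intro Δ S hS h2 hU n x hx
  obtain ⟨u, -, hconv⟩ := hS
  rcases Nat.even_or_odd n with hev | hodd
  · -- even order `n = 2 * m`
    obtain ⟨m, rfl⟩ : ∃ m, n = 2 * m := ⟨n / 2, by obtain ⟨k, hk⟩ := hev; omega⟩
    rcases Nat.lt_or_ge m 2 with hm | hm
    · interval_cases m
      · -- order `0`: `⟨1⟩ = 1`
        have h1 : Tendsto (fun k => rescaledCorrelator (criticalCorr 3) rhoPin (2 * 0) (u k) x) atTop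
            (𝓝 1) :=
          tendsto_const_nhds.congr fun k => (rescaledCorrelator_criticalCorr_zero rhoPin (u k) x).symm
        have h0 : S (2 * 0) x = 1 := tendsto_nhds_unique ((hconv (2 * 0)).tendsto_at hx) h1
        have hW : wickPower Δ (2 * 0) x = 1 := wickPower_zero Δ x
        rw [h0, hW]
      · -- order `2`: the two-point law
        have e2 : S (2 * 1) x = ‖x 0 - x 1‖ ^ (-(2 * Δ)) := h2 x hx
        have hW : wickPower Δ (2 * 1) x = ‖x 0 - x 1‖ ^ (-(2 * Δ)) := wickPower_two hx
        rw [e2, hW]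
    · -- order `2m ≥ 4`: the sequential dichotomy, then the two-point law at distinct indices
      have hinj : Function.Injective x := hx
      rw [eq_pairingSum_of_seq_of_limitConnectedFour_eq_zero hconv hU hm hx, wickPower_of_mem_even hx,
        PairIsing.pairingSum_eq_pow_mul (powerKernel Δ) (fun p q => S 2 ![p, q]) 1 m x x
          fun i j hij => ?_, one_pow, one_mul]
      have hmem : (![x i, x j] : Fin 2 → EuclideanSpace ℝ (Fin 3)) ∈ NonCoincident 3 2 :=
        pair_mem_nonCoincident fun h => hij (hinj h)
      show S 2 ![x i, x j] = 1 * powerKernel Δ (x i) (x j)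
      rw [h2 _ hmem, one_mul]
      rfl
  · -- odd order: `m*(β_c) = 0`
    have h0 : Tendsto (fun k => rescaledCorrelator (criticalCorr 3) rhoPin n (u k) x) atTop (𝓝 0) := by
      refine tendsto_const_nhds.congr fun k => ?_
      rw [rescaledCorrelator_apply, criticalCorr_eq_zero_of_odd (d := 3) le_rfl hodd, mul_zero]
    rw [wickPower_of_odd hodd, tendsto_nhds_unique ((hconv n).tendsto_at hx) h0]

end Summit.CriticalPhenomena.Ising3DConformalLimit.MoebiusLimitExistsOnlyInteraction

end
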